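import Literature.Analysis.FluidPDE.TorusNSVectorFieldHolder
import HarnessLib

/-!
# The linearisation remainder and the continuity of the linearisation of the projected
# Navier–Stokes vector field, in `H¹`, on Gevrey balls of `T³`

Analysis/FluidPDE proof file (theorems only; no definitions, no named facts), sequel of
`TorusNSVectorFieldHolder.lean` (Hölder continuity in `H¹` of `G(u) = νΔu − P((u·∇)u)` on Gevrey balls;
`P v = v − ∇Δ⁻¹div v`).  With the linearisation `DG(u)[w] = P(νΔw − (u·∇)w − (w·∇)u)` we prove the two
quantitative facts behind the Fréchet differentiability (in the datum) of the time-derivative field of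
bounded-enstrophy Navier–Stokes trajectories and the continuity of the resulting operator field
(Constantin–Foias 1988, Ch. 14: "`S'(t, u₀)` is the Fréchet derivative of `S(t)`", there in `L²`; here at
the level of `∂ₜS(t)u₀ = G(S(t)u₀)` in `H¹`, using Gevrey regularity, Foias–Temam 1989):

* `Torus.exists_h1_linearisationRemainder_le` (**remainder**, `card d = 3`): for `u` in a Gevrey ball,
  `δ` Gevrey of level `D` and any smooth `w` with `r = δ − w` small in `H³`
  (`∑_{k∈S} (1 + |k|²)³ ‖r̂(k)‖² ≤ ε`, `∫ r = 0`),
  `‖P(νΔδ − (u·∇)δ − (δ·∇)u − (δ·∇)δ) − DG(u)[w]‖²_{H¹} ≤ K (ε + D²)`, `K = K(ν, σ₁, C₁, σ₂)`: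
  the left side is `P(νΔr − (u·∇)r − (r·∇)u − (δ·∇)δ)` (linearity), `P` is an `L²`/`H¹` contraction,
  the linear part is `O(ε)` by the `H¹` product estimate `Torus.h1_convect_add_convect_le_three` with the
  sup bounds of `u` on the Gevrey ball and of the zero-mean `r` (`Torus.norm_sq_le_gradNormSq_add_of_hasZeroMean`),
  and the quadratic part is `O(D²)` (transport shape `Torus.gradNormSq_convect_le_of_norm_left_le` with the
  sup bounds of `δ`, `∂δ`, `Δδ`, all `O(√D)` on a Gevrey ball of level `D`);
* `Torus.exists_h1_linearisation_sub_le` (**continuity of `(u, w) ↦ DG(u)[w]`**, `card d = 3`):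
  `‖DG(u)[w] − DG(u')[w']‖²_{H¹} ≤ K (ε_w + ε_u)` when `u` is in a Gevrey ball, `w'` is Gevrey of level `D`,
  and `w − w'`, `u − u'` (zero mean) have `H³`-sums `≤ ε_w`, `≤ ε_u`
  (`DG(u)[w] − DG(u')[w'] = P(νΔr − (u·∇)r − (r·∇)u − ((w'·∇)η + (η·∇)w'))`, `r = w − w'`, `η = u − u'`).

Auxiliary: the `L²`, `‖∇·‖₂²`, `‖Δ·‖₂²`, `‖∇Δ·‖₂²` consequences of an `H³`-sum bound
(`Torus.sobolev_quantities_le_of_sum_le`, spectral moments) and the sup / Sobolev bounds LINEAR in the level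
of a Gevrey bound (`Torus.sup_quantities_le_of_gevreyBound`).

## Mathlib / tree search

Tree (reused): `TorusNSVectorFieldHolder` (`h1_convect_add_convect_le_three`, `integral_norm_sq_fun_sub_le`,
`gradNormSq_fun_sub_le`, `gradNormSq_fun_const_smul`, `integral_norm_sq_const_smul`), `TorusLerayHelmholtzH1`
(`integral_norm_sq_leray_sub_le`, `gradNormSq_leray_sub_le`), `TorusConvectionGradNormSq`
(`norm_sq_le_gradNormSq_add_of_hasZeroMean`), `TorusConvectionLaplacianNormSq` (`gradNormSq_convect_le_of_norm_left_le`),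
`TorusClassicalNSDifferenceBalances` (`norm_convect_sq_le_of_norm_le`), `TorusGevreySobolevBounds` (modewise sup
bounds, `exists_sobolevBounds_of_gevreyBound`), the spectral moments of `TorusNSGevreySums` /
`TorusSobolevInterpolationCS`; Mathlib `hasSum_le_of_sum_le`.  Searched `linearisationRemainder`, `DG(u)`,
`Frechet.*nsVectorField`: nothing beyond the Hölder estimate of `TorusNSVectorFieldHolder` and the `L²`-level
remainder of the solution map (`TorusClassicalNSLinearisation`).

## References

* P. Constantin, C. Foias, *Navier–Stokes Equations*, Univ. Chicago Press 1988, Ch. 14, Lemma 14.3 (14.10).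
  [ConstantinFoiasNSE1988]
* J. C. Robinson, J. L. Rodrigo, W. Sadowski, *The Three-Dimensional Navier–Stokes Equations*, CUP 2016,
  proof of Thm 7.1 ((7.3), product estimates), Thm. 2.6 (Leray projector). [RobinsonRodrigoSadowskiCUP2016]
* C. Foias, R. Temam, J. Funct. Anal. 87 (1989), 359–369 (Gevrey classes). [FoiasTemam1989]
-/

noncomputable section

open _root_.MeasureTheory Set Filter Function UnitAddTorus
open scoped InnerProductSpace ContDiff Topology BigOperators

namespace Literature.Analysis.FluidPDE

namespace Torus

open Literature.Analysis.FunctionSpaces Literature.Analysis.FunctionSpaces.Torus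

variable {d : Type*} [Fintype d] [DecidableEq d]

/-! ### Consequences of an `H³`-sum bound and of a Gevrey bound -/

section Spectral

variable {v : UnitAddTorus d → EuclideanSpace ℝ d} {ε : ℝ}

omit [DecidableEq d] in
/-- Termwise: `(4π²|k|²)ʲ a ≤ (4π²)ʲ (1 + |k|²)³ a` for `j ≤ 3` and `a ≥ 0`. [folklore] -/
theorem laplacianSymbol_pow_mul_le {j : ℕ} (hj : j ≤ 3) (k : d → ℤ) {a : ℝ} (ha : 0 ≤ a) :
    (4 * Real.pi ^ 2 * freqNormSq k) ^ j * a ≤ (4 * Real.pi ^ 2) ^ j * ((1 + freqNormSq k) ^ 3 * a) := by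
  have h0 : 0 ≤ freqNormSq k := freqNormSq_nonneg k
  have h1 : freqNormSq k ^ j ≤ (1 + freqNormSq k) ^ j := pow_le_pow_left₀ h0 (by linarith) j
  have h2 : (1 + freqNormSq k) ^ j ≤ (1 + freqNormSq k) ^ 3 := pow_le_pow_right₀ (by linarith) hj
  rw [mul_pow, mul_assoc]
  exact mul_le_mul_of_nonneg_left (mul_le_mul_of_nonneg_right (h1.trans h2) ha) (by positivity)

/-- **`L²`, `H¹`, `H²`, `H³` quantities under an `H³`-sum bound**: if `∑_{k∈S} (1 + |k|²)³ ‖v̂(k)‖² ≤ ε` for all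
finite `S` then `∫‖v‖² ≤ ε`, `‖∇v‖₂² ≤ 4π² ε`, `∫‖Δv‖² ≤ (4π²)² ε`, `‖∇Δv‖₂² ≤ (4π²)³ ε` (the spectral moments
`∑ (4π²|k|²)ʲ ‖v̂‖²`, `j = 0, 1, 2, 3`, are these quantities; Grafakos 2014, Prop. 3.2.7 (3)). [folklore] -/
theorem sobolev_quantities_le_of_sum_le (hv : IsSmooth v)
    (h : ∀ S : Finset (d → ℤ), ∑ k ∈ S, (1 + freqNormSq k) ^ 3 *
      ‖mFourierCoeff (EuclideanSpace.complexify ∘ v) k‖ ^ 2 ≤ ε) :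
    (∫ x, ‖v x‖ ^ 2) ≤ ε ∧ gradNormSq v ≤ 4 * Real.pi ^ 2 * ε ∧
      (∫ x, ‖laplacian v x‖ ^ 2) ≤ (4 * Real.pi ^ 2) ^ 2 * ε ∧ gradNormSq (laplacian v) ≤ (4 * Real.pi ^ 2) ^ 3 * ε := by
  have hS : ∀ {j : ℕ}, j ≤ 3 → ∀ S : Finset (d → ℤ), ∑ k ∈ S, (4 * Real.pi ^ 2 * freqNormSq k) ^ j *
      ‖mFourierCoeff (EuclideanSpace.complexify ∘ v) k‖ ^ 2 ≤ (4 * Real.pi ^ 2) ^ j * ε := by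
    intro j hj S
    calc ∑ k ∈ S, (4 * Real.pi ^ 2 * freqNormSq k) ^ j * ‖mFourierCoeff (EuclideanSpace.complexify ∘ v) k‖ ^ 2
        ≤ ∑ k ∈ S, (4 * Real.pi ^ 2) ^ j * ((1 + freqNormSq k) ^ 3 * ‖mFourierCoeff (EuclideanSpace.complexify ∘ v) k‖ ^ 2) :=
          Finset.sum_le_sum fun k _ => laplacianSymbol_pow_mul_le hj k (sq_nonneg _)
      _ = (4 * Real.pi ^ 2) ^ j * ∑ k ∈ S, (1 + freqNormSq k) ^ 3 * ‖mFourierCoeff (EuclideanSpace.complexify ∘ v) k‖ ^ 2 := by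
          rw [Finset.mul_sum]
      _ ≤ (4 * Real.pi ^ 2) ^ j * ε := mul_le_mul_of_nonneg_left (h S) (by positivity)
  refine ⟨?_, ?_, ?_, ?_⟩
  · have h0 := hS (j := 0) (by norm_num)
    simp only [pow_zero, one_mul] at h0
    exact hasSum_le_of_sum_le (hasSum_sq_norm_mFourierCoeff_complexify (hv.memLp 2)) h0
  · have h1 := hS (j := 1) (by norm_num)
    simp only [pow_one] at h1
    exact hasSum_le_of_sum_le (NSGevrey.hasSum_freqNormSq_mul_norm_sq_mFourierCoeff hv) h1
  · exact hasSum_le_of_sum_le (NSGevrey.hasSum_freqNormSq_sq_mul_norm_sq_mFourierCoeff hv) (hS (j := 2) (by norm_num))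
  · exact hasSum_le_of_sum_le (hasSum_laplacianSymbol_pow_three_mul_norm_sq_mFourierCoeff hv) (hS (j := 3) le_rfl)

omit [DecidableEq d] in
/-- An `H³`-sum bound is nonnegative (`S = ∅`). [folklore] -/
theorem nonneg_of_sum_le (h : ∀ S : Finset (d → ℤ), ∑ k ∈ S, (1 + freqNormSq k) ^ 3 *
      ‖mFourierCoeff (EuclideanSpace.complexify ∘ v) k‖ ^ 2 ≤ ε) : 0 ≤ ε := by
  simpa using h ∅

variable {σ D : ℝ}

/-- **Sup and Sobolev bounds LINEAR in the level of a Gevrey bound**: with `Z₀ = ∑ₖ e^{-σ|k|}`,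
`Z₁ = ∑ₖ (1 + |k|²) e^{-σ|k|}`, a smooth `v` with `∑_{k∈S} e^{2σ|k|} ‖v̂(k)‖² ≤ D` (all finite `S`) satisfies
`‖v(x)‖ ≤ √D Z₀`, `‖∂ᵢv(x)‖ ≤ 2π √D Z₁`, `‖∇v‖₂² ≤ #d (2π √D Z₁)²`, `∫‖Δv‖² ≤ (4π² √D Z₁)²`
(the modewise bounds of `TorusGevreySobolevBounds`). [folklore] -/
theorem sup_quantities_le_of_gevreyBound (hσ : 0 < σ) (hv : IsSmooth v)
    (h : ∀ S : Finset (d → ℤ), ∑ k ∈ S, Real.exp (2 * σ * Real.sqrt (freqNormSq k)) *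
      ‖mFourierCoeff (EuclideanSpace.complexify ∘ v) k‖ ^ 2 ≤ D) :
    (∀ x, ‖v x‖ ≤ Real.sqrt D * ∑' k : d → ℤ, Real.exp (-(σ * Real.sqrt (freqNormSq k)))) ∧
      (∀ i x, ‖partialDeriv i v x‖ ≤ 2 * Real.pi * Real.sqrt D *
        ∑' k : d → ℤ, (1 + freqNormSq k) * Real.exp (-(σ * Real.sqrt (freqNormSq k)))) ∧
      gradNormSq v ≤ Fintype.card d * (2 * Real.pi * Real.sqrt D *
        ∑' k : d → ℤ, (1 + freqNormSq k) * Real.exp (-(σ * Real.sqrt (freqNormSq k)))) ^ 2 ∧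
      (∫ x, ‖laplacian v x‖ ^ 2) ≤ (4 * Real.pi ^ 2 * Real.sqrt D *
        ∑' k : d → ℤ, (1 + freqNormSq k) * Real.exp (-(σ * Real.sqrt (freqNormSq k)))) ^ 2 :=
  ⟨norm_apply_le_of_gevreyBound hσ hv h, norm_partialDeriv_apply_le_of_gevreyBound hσ hv h,
    gradNormSq_le_of_forall_norm_partialDeriv_le (norm_partialDeriv_apply_le_of_gevreyBound hσ hv h),
    integral_norm_sq_le_of_forall_norm_le (norm_laplacian_apply_le_of_gevreyBound hσ hv h)⟩

end Spectral

/-! ### The linear part `νΔr − (u·∇)r − (r·∇)u` is `O(‖r‖_{H³})` in `H¹` on `T³` -/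

section Linear

variable {u r : UnitAddTorus d → EuclideanSpace ℝ d}

/-- **`H¹` bound of the (unprojected) linearisation, `T³`**: for smooth `u` with `‖u‖ ≤ M`, `‖∂ᵢu‖ ≤ Λ`,
`∫‖Δu‖² ≤ Y`, a constant `K₃` of `Torus.norm_sq_le_gradNormSq_add_of_hasZeroMean`, and a smooth zero-mean `r`
with `∑_{k∈S} (1 + |k|²)³ ‖r̂(k)‖² ≤ ε`, the field `A = νΔr − ((u·∇)r + (r·∇)u)` satisfies
`∫‖A‖² + ‖∇A‖₂² ≤ K_A ε` with
`K_A = 2ν²((4π²)² + (4π²)³) + 2(18Λ² + (6M² + 72Λ²)4π² + 12M²(4π²)² + 12K₃(4π² + (4π²)²) Y)`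
(`Torus.h1_convect_add_convect_le_three`, the sup bound of the zero-mean `r`, and the spectral moments).
[cite: RobinsonRodrigoSadowskiCUP2016, proof of Thm 7.1 (7.3)] -/
theorem h1_linearisation_le (hd : Fintype.card d = 3) {ν M Λ Y K₃ ε : ℝ} (hu : IsSmooth u) (hM : ∀ x, ‖u x‖ ≤ M)
    (hΛ : ∀ (k : d) (x : UnitAddTorus d), ‖partialDeriv k u x‖ ≤ Λ) (hY : (∫ x, ‖laplacian u x‖ ^ 2) ≤ Y)
    (hK₃ : ∀ w : UnitAddTorus d → EuclideanSpace ℝ d, IsSmooth w → HasZeroMean w → ∀ x,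
      ‖w x‖ ^ 2 ≤ K₃ * (gradNormSq w + ∫ y, ‖laplacian w y‖ ^ 2))
    (hK₃0 : 0 ≤ K₃) (hr : IsSmooth r) (hrz : HasZeroMean r)
    (hε : ∀ S : Finset (d → ℤ), ∑ k ∈ S, (1 + freqNormSq k) ^ 3 * ‖mFourierCoeff (EuclideanSpace.complexify ∘ r) k‖ ^ 2 ≤ ε) :
    (∫ x, ‖ν • laplacian r x - (convect u r x + convect r u x)‖ ^ 2) +
        gradNormSq (fun x => ν • laplacian r x - (convect u r x + convect r u x)) ≤
      (2 * ν ^ 2 * ((4 * Real.pi ^ 2) ^ 2 + (4 * Real.pi ^ 2) ^ 3) +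
        2 * (18 * Λ ^ 2 + (6 * M ^ 2 + 72 * Λ ^ 2) * (4 * Real.pi ^ 2) + 12 * M ^ 2 * (4 * Real.pi ^ 2) ^ 2 +
          12 * K₃ * (4 * Real.pi ^ 2 + (4 * Real.pi ^ 2) ^ 2) * Y)) * ε := by
  obtain ⟨h0, h1, h2, h3⟩ := sobolev_quantities_le_of_sum_le hr hε
  have hε0 : 0 ≤ ε := nonneg_of_sum_le hε
  -- the sup bound of the zero-mean `r`
  set M₀ : ℝ := Real.sqrt (K₃ * (gradNormSq r + ∫ y, ‖laplacian r y‖ ^ 2)) with hM₀def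
  have hM₀ : ∀ x, ‖r x‖ ≤ M₀ := fun x => Real.le_sqrt_of_sq_le (hK₃ r hr hrz x)
  have hM₀sq : M₀ ^ 2 ≤ K₃ * (4 * Real.pi ^ 2 + (4 * Real.pi ^ 2) ^ 2) * ε := by
    rw [hM₀def, Real.sq_sqrt (mul_nonneg hK₃0 (add_nonneg (gradNormSq_nonneg _) (integral_nonneg fun _ => sq_nonneg _)))]
    nlinarith [mul_le_mul_of_nonneg_left (add_le_add h1 h2) hK₃0]
  -- the two summands
  have hΔ : IsSmooth (fun x => ν • laplacian r x) := hr.laplacian.smul ν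
  have hV : IsSmooth (fun x => convect u r x + convect r u x) := (hu.convect hr).add (hr.convect hu)
  have hs1 := integral_norm_sq_fun_sub_le hΔ hV
  have hs2 := gradNormSq_fun_sub_le hΔ hV
  rw [integral_norm_sq_const_smul] at hs1
  rw [gradNormSq_fun_const_smul hr.laplacian] at hs2
  have hprod := h1_convect_add_convect_le_three hd hu hu hr hM hΛ hΛ hM₀
  -- bookkeeping
  have hY0 : 0 ≤ ∫ x, ‖laplacian u x‖ ^ 2 := integral_nonneg fun _ => sq_nonneg _
  have hA : ν ^ 2 * (∫ x, ‖laplacian r x‖ ^ 2) + ν ^ 2 * gradNormSq (laplacian r) ≤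
      ν ^ 2 * ((4 * Real.pi ^ 2) ^ 2 + (4 * Real.pi ^ 2) ^ 3) * ε := by
    nlinarith [mul_le_mul_of_nonneg_left h2 (sq_nonneg ν), mul_le_mul_of_nonneg_left h3 (sq_nonneg ν)]
  have hB : 18 * Λ ^ 2 * (∫ x, ‖r x‖ ^ 2) + (6 * M ^ 2 + 72 * Λ ^ 2) * gradNormSq r +
      12 * M ^ 2 * (∫ x, ‖laplacian r x‖ ^ 2) + 12 * M₀ ^ 2 * (∫ x, ‖laplacian u x‖ ^ 2) ≤
      (18 * Λ ^ 2 + (6 * M ^ 2 + 72 * Λ ^ 2) * (4 * Real.pi ^ 2) + 12 * M ^ 2 * (4 * Real.pi ^ 2) ^ 2 +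
        12 * K₃ * (4 * Real.pi ^ 2 + (4 * Real.pi ^ 2) ^ 2) * Y) * ε := by
    have e1 : 18 * Λ ^ 2 * (∫ x, ‖r x‖ ^ 2) ≤ 18 * Λ ^ 2 * ε := mul_le_mul_of_nonneg_left h0 (by positivity)
    have e2 : (6 * M ^ 2 + 72 * Λ ^ 2) * gradNormSq r ≤ (6 * M ^ 2 + 72 * Λ ^ 2) * (4 * Real.pi ^ 2 * ε) :=
      mul_le_mul_of_nonneg_left h1 (by positivity)
    have e3 : 12 * M ^ 2 * (∫ x, ‖laplacian r x‖ ^ 2) ≤ 12 * M ^ 2 * ((4 * Real.pi ^ 2) ^ 2 * ε) :=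
      mul_le_mul_of_nonneg_left h2 (by positivity)
    have e4 : 12 * M₀ ^ 2 * (∫ x, ‖laplacian u x‖ ^ 2) ≤ 12 * (K₃ * (4 * Real.pi ^ 2 + (4 * Real.pi ^ 2) ^ 2) * ε) * Y :=
      mul_le_mul (mul_le_mul_of_nonneg_left hM₀sq (by norm_num)) hY hY0 (by positivity)
    nlinarith [e1, e2, e3, e4]
  nlinarith [hs1, hs2, hprod, hA, hB]

end Linear

/-! ### The linearisation remainder -/

section Remainder

/-- **Assembly through the projection**: if `v₁ − v₂ = A − Q` pointwise for smooth fields with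
`∫‖A‖² + ‖∇A‖₂² ≤ a` and `∫‖Q‖² + ‖∇Q‖₂² ≤ q`, then `∫‖P v₁ − P v₂‖² + ‖∇(P v₁ − P v₂)‖₂² ≤ 2a + 2q`
(`P` contracts `L²` and `‖∇·‖₂`, `Torus.integral_norm_sq_leray_sub_le`, `Torus.gradNormSq_leray_sub_le`, and
`(x − y)² ≤ 2x² + 2y²`). [folklore] -/
theorem h1_leray_sub_le_of_sub_eq [Nonempty d] {v₁ v₂ A Q : UnitAddTorus d → EuclideanSpace ℝ d}
    (hv₁ : IsSmooth v₁) (hv₂ : IsSmooth v₂) (hA : IsSmooth A) (hQ : IsSmooth Q)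
    (h : ∀ x, v₁ x - v₂ x = A x - Q x) {a q : ℝ} (ha : (∫ x, ‖A x‖ ^ 2) + gradNormSq A ≤ a)
    (hq : (∫ x, ‖Q x‖ ^ 2) + gradNormSq Q ≤ q) :
    (∫ x, ‖(v₁ x - Torus.gradient (invLaplacian (divergence v₁)) x) -
        (v₂ x - Torus.gradient (invLaplacian (divergence v₂)) x)‖ ^ 2) +
      gradNormSq (fun x => (v₁ x - Torus.gradient (invLaplacian (divergence v₁)) x) -
        (v₂ x - Torus.gradient (invLaplacian (divergence v₂)) x)) ≤ 2 * a + 2 * q := by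
  have hPL2 := integral_norm_sq_leray_sub_le hv₁ hv₂
  have hPH1 := gradNormSq_leray_sub_le hv₁ hv₂
  have hfun : v₁ - v₂ = fun x => A x - Q x := funext fun x => by rw [Pi.sub_apply, h x]
  rw [hfun] at hPH1
  simp only [h] at hPL2
  have h1 := integral_norm_sq_fun_sub_le hA hQ
  have h2 := gradNormSq_fun_sub_le hA hQ
  have hA0 : 0 ≤ ∫ x, ‖A x‖ ^ 2 := integral_nonneg fun _ => sq_nonneg _
  have hQ0 : 0 ≤ ∫ x, ‖Q x‖ ^ 2 := integral_nonneg fun _ => sq_nonneg _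
  linarith [gradNormSq_nonneg A, gradNormSq_nonneg Q]

/-- **`H¹` size of the quadratic term `(δ·∇)δ` on a Gevrey ball of `T³`**: with `Z₀ = ∑ₖ e^{-σ|k|}`,
`Z₁ = ∑ₖ (1 + |k|²) e^{-σ|k|}`, a smooth `δ` with `∑_{k∈S} e^{2σ|k|}‖δ̂(k)‖² ≤ D` satisfies
`∫‖(δ·∇)δ‖² + ‖∇((δ·∇)δ)‖₂² ≤ (36π² Z₀²Z₁² + 96π⁴ Z₀²Z₁² + 864π⁴ Z₁⁴) D²` (`card d = 3`; the transport
shape with the `O(√D)` sup bounds of `δ`, `∂δ`, `Δδ`). [folklore] -/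
theorem h1_convect_self_le_of_gevreyBound (hd : Fintype.card d = 3) {σ D : ℝ} (hσ : 0 < σ)
    {δ : UnitAddTorus d → EuclideanSpace ℝ d} (hδ : IsSmooth δ)
    (hG : ∀ S : Finset (d → ℤ), ∑ k ∈ S, Real.exp (2 * σ * Real.sqrt (freqNormSq k)) *
      ‖mFourierCoeff (EuclideanSpace.complexify ∘ δ) k‖ ^ 2 ≤ D) :
    (∫ x, ‖convect δ δ x‖ ^ 2) + gradNormSq (convect δ δ) ≤
      (36 * Real.pi ^ 2 * (∑' k : d → ℤ, Real.exp (-(σ * Real.sqrt (freqNormSq k)))) ^ 2 *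
          (∑' k : d → ℤ, (1 + freqNormSq k) * Real.exp (-(σ * Real.sqrt (freqNormSq k)))) ^ 2 +
        96 * Real.pi ^ 4 * (∑' k : d → ℤ, Real.exp (-(σ * Real.sqrt (freqNormSq k)))) ^ 2 *
          (∑' k : d → ℤ, (1 + freqNormSq k) * Real.exp (-(σ * Real.sqrt (freqNormSq k)))) ^ 2 +
        864 * Real.pi ^ 4 * (∑' k : d → ℤ, (1 + freqNormSq k) * Real.exp (-(σ * Real.sqrt (freqNormSq k)))) ^ 4) * D ^ 2 := by
  set Z₀ : ℝ := ∑' k : d → ℤ, Real.exp (-(σ * Real.sqrt (freqNormSq k))) with hZ₀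
  set Z₁ : ℝ := ∑' k : d → ℤ, (1 + freqNormSq k) * Real.exp (-(σ * Real.sqrt (freqNormSq k))) with hZ₁
  have hD0 : 0 ≤ D := gevreyBound_nonneg hG
  have hsqD : Real.sqrt D ^ 2 = D := Real.sq_sqrt hD0
  obtain ⟨hδ0, hδ1, hδg, hδΔ⟩ := sup_quantities_le_of_gevreyBound hσ hδ hG
  rw [← hZ₀] at hδ0
  rw [← hZ₁] at hδ1 hδg hδΔ
  rw [hd] at hδg
  push_cast at hδg
  set m₀ : ℝ := Real.sqrt D * Z₀ with hm₀
  set m₁ : ℝ := 2 * Real.pi * Real.sqrt D * Z₁ with hm₁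
  set m₂ : ℝ := 4 * Real.pi ^ 2 * Real.sqrt D * Z₁ with hm₂
  have e0 : m₀ ^ 2 = D * Z₀ ^ 2 := by rw [hm₀, mul_pow, hsqD]
  have e1 : m₁ ^ 2 = 4 * Real.pi ^ 2 * D * Z₁ ^ 2 := by rw [hm₁]; ring_nf; rw [hsqD]; ring
  have e2 : m₂ ^ 2 = 16 * Real.pi ^ 4 * D * Z₁ ^ 2 := by rw [hm₂]; ring_nf; rw [hsqD]; ring
  -- `L²` of `(δ·∇)δ`
  have hL2 : ∫ x, ‖convect δ δ x‖ ^ 2 ≤ 3 * m₀ ^ 2 * gradNormSq δ := by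
    have hpt : ∀ x, ‖convect δ δ x‖ ^ 2 ≤ 3 * m₀ ^ 2 * ∑ i, ‖partialDeriv i δ x‖ ^ 2 := fun x => by
      have h := norm_convect_sq_le_of_norm_le (u := δ) hδ hδ0 x
      rw [hd] at h
      push_cast at h
      exact h
    calc ∫ x, ‖convect δ δ x‖ ^ 2 ≤ ∫ x, 3 * m₀ ^ 2 * ∑ i, ‖partialDeriv i δ x‖ ^ 2 :=
          integral_mono (hδ.convect hδ).norm_sq.integrable
            ((integrable_finsetSum _ fun i _ => ((hδ.partialDeriv i).norm_sq).integrable).const_mul _) hpt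
      _ = 3 * m₀ ^ 2 * gradNormSq δ := by rw [integral_const_mul]; rfl
  -- `‖∇((δ·∇)δ)‖₂²`
  have hH1 := gradNormSq_convect_le_of_norm_left_le hδ hδ hδ0 hδ1
  rw [hd] at hH1
  push_cast at hH1
  -- products
  have hg0 : 0 ≤ gradNormSq δ := gradNormSq_nonneg _
  have f1 : 3 * m₀ ^ 2 * gradNormSq δ ≤ 3 * m₀ ^ 2 * (3 * m₁ ^ 2) := mul_le_mul_of_nonneg_left hδg (by positivity)
  have f2 : 2 * 3 * m₀ ^ 2 * (∫ x, ‖laplacian δ x‖ ^ 2) ≤ 2 * 3 * m₀ ^ 2 * m₂ ^ 2 :=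
    mul_le_mul_of_nonneg_left hδΔ (by positivity)
  have f3 : 2 * 3 ^ 2 * m₁ ^ 2 * gradNormSq δ ≤ 2 * 3 ^ 2 * m₁ ^ 2 * (3 * m₁ ^ 2) :=
    mul_le_mul_of_nonneg_left hδg (by positivity)
  have hval : 3 * m₀ ^ 2 * (3 * m₁ ^ 2) + 2 * 3 * m₀ ^ 2 * m₂ ^ 2 + 2 * 3 ^ 2 * m₁ ^ 2 * (3 * m₁ ^ 2) =
      (36 * Real.pi ^ 2 * Z₀ ^ 2 * Z₁ ^ 2 + 96 * Real.pi ^ 4 * Z₀ ^ 2 * Z₁ ^ 2 + 864 * Real.pi ^ 4 * Z₁ ^ 4) * D ^ 2 := by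
    have h11 : m₁ ^ 2 * m₁ ^ 2 = (4 * Real.pi ^ 2 * D * Z₁ ^ 2) * (4 * Real.pi ^ 2 * D * Z₁ ^ 2) := by rw [e1]
    have h01 : m₀ ^ 2 * m₁ ^ 2 = (D * Z₀ ^ 2) * (4 * Real.pi ^ 2 * D * Z₁ ^ 2) := by rw [e0, e1]
    have h02 : m₀ ^ 2 * m₂ ^ 2 = (D * Z₀ ^ 2) * (16 * Real.pi ^ 4 * D * Z₁ ^ 2) := by rw [e0, e2]
    linear_combination (9 : ℝ) * h01 + (6 : ℝ) * h02 + (54 : ℝ) * h11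
  linarith [hL2, hH1, f1, f2, f3, hval]

/-- **The linearisation remainder of the projected vector field in `H¹` on Gevrey balls of `T³`.**  On `T^d` with
`card d = 3`, for `ν`, Gevrey radii `σ₁, σ₂ > 0` and a level `C₁` there is `K ≥ 0` such that: for smooth `u, δ, w`
with `∫(δ − w) = 0`, `u` in the Gevrey ball `∑_{k∈S} e^{2σ₁|k|}‖û(k)‖² ≤ C₁`, `δ` Gevrey of level `D` at radius `σ₂`,
and `r = δ − w` with `∑_{k∈S}(1 + |k|²)³‖r̂(k)‖² ≤ ε` (all finite `S`), the field
`X = P(νΔδ − ((u·∇)δ + (δ·∇)u) − (δ·∇)δ) − P(νΔw − ((u·∇)w + (w·∇)u))` (`P v = v − ∇Δ⁻¹div v`; by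
`Torus.IsClassicalNSSolutionOn.timeDerivWithin_sub_eq_leray` this is `∂ₜu₁ − ∂ₜu₂ − DG(u₂)[w]` for two NS solutions
with `δ = u₁ − u₂`, `u = u₂`) satisfies `∫‖X‖² + ‖∇X‖₂² ≤ K (ε + D²)`: `X = P(νΔr − (u·∇)r − (r·∇)u − (δ·∇)δ)`,
`P` contracts `L²` and `‖∇·‖₂`, the linear part is `O(ε)` (`Torus.h1_linearisation_le`) and the quadratic part is
`O(D²)` (`Torus.h1_convect_self_le_of_gevreyBound`).  With `D = O(‖h‖²)` and `ε = o(‖h‖²)` this is the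
`o(‖h‖)` estimate of the remainder of the `y`-derivative of the time-derivative field of the NS solution map.
[cite: ConstantinFoiasNSE1988, Ch. 14 Lemma 14.3 (14.10)] -/
theorem exists_h1_linearisationRemainder_le [Nonempty d] (hd : Fintype.card d = 3) (ν σ₁ C₁ σ₂ : ℝ) (hσ₁ : 0 < σ₁)
    (hσ₂ : 0 < σ₂) :
    ∃ K : ℝ, 0 ≤ K ∧ ∀ (u δ w : UnitAddTorus d → EuclideanSpace ℝ d), IsSmooth u → IsSmooth δ → IsSmooth w →
      HasZeroMean (fun x => δ x - w x) →
      (∀ S : Finset (d → ℤ), ∑ k ∈ S, Real.exp (2 * σ₁ * Real.sqrt (freqNormSq k)) *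
        ‖mFourierCoeff (EuclideanSpace.complexify ∘ u) k‖ ^ 2 ≤ C₁) →
      ∀ D : ℝ, (∀ S : Finset (d → ℤ), ∑ k ∈ S, Real.exp (2 * σ₂ * Real.sqrt (freqNormSq k)) *
        ‖mFourierCoeff (EuclideanSpace.complexify ∘ δ) k‖ ^ 2 ≤ D) →
      ∀ ε : ℝ, (∀ S : Finset (d → ℤ), ∑ k ∈ S, (1 + freqNormSq k) ^ 3 *
        ‖mFourierCoeff (EuclideanSpace.complexify ∘ fun x => δ x - w x) k‖ ^ 2 ≤ ε) →
      (∫ x, ‖((ν • laplacian δ x - (convect u δ x + convect δ u x) - convect δ δ x) -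
            Torus.gradient (invLaplacian (divergence fun y =>
              ν • laplacian δ y - (convect u δ y + convect δ u y) - convect δ δ y)) x) -
          ((ν • laplacian w x - (convect u w x + convect w u x)) -
            Torus.gradient (invLaplacian (divergence fun y => ν • laplacian w y - (convect u w y + convect w u y))) x)‖ ^ 2) +
        gradNormSq (fun x => ((ν • laplacian δ x - (convect u δ x + convect δ u x) - convect δ δ x) -
            Torus.gradient (invLaplacian (divergence fun y =>
              ν • laplacian δ y - (convect u δ y + convect δ u y) - convect δ δ y)) x) -
          ((ν • laplacian w x - (convect u w x + convect w u x)) -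
            Torus.gradient (invLaplacian (divergence fun y => ν • laplacian w y - (convect u w y + convect w u y))) x)) ≤
        K * (ε + D ^ 2) := by
  -- constants: the Gevrey ball of `u`, the sup-bound constant of zero-mean fields, the quadratic constant at `σ₂`
  obtain ⟨B, hB⟩ := exists_sobolevBounds_of_gevreyBound (d := d) hσ₁ C₁
  obtain ⟨K₃, hK₃pos, hK₃⟩ := norm_sq_le_gradNormSq_add_of_hasZeroMean hd
  set KA : ℝ := 2 * ν ^ 2 * ((4 * Real.pi ^ 2) ^ 2 + (4 * Real.pi ^ 2) ^ 3) +
    2 * (18 * B ^ 2 + (6 * B ^ 2 + 72 * B ^ 2) * (4 * Real.pi ^ 2) + 12 * B ^ 2 * (4 * Real.pi ^ 2) ^ 2 +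
      12 * K₃ * (4 * Real.pi ^ 2 + (4 * Real.pi ^ 2) ^ 2) * B) with hKA
  set Q : ℝ := 36 * Real.pi ^ 2 * (∑' k : d → ℤ, Real.exp (-(σ₂ * Real.sqrt (freqNormSq k)))) ^ 2 *
      (∑' k : d → ℤ, (1 + freqNormSq k) * Real.exp (-(σ₂ * Real.sqrt (freqNormSq k)))) ^ 2 +
    96 * Real.pi ^ 4 * (∑' k : d → ℤ, Real.exp (-(σ₂ * Real.sqrt (freqNormSq k)))) ^ 2 *
      (∑' k : d → ℤ, (1 + freqNormSq k) * Real.exp (-(σ₂ * Real.sqrt (freqNormSq k)))) ^ 2 +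
    864 * Real.pi ^ 4 * (∑' k : d → ℤ, (1 + freqNormSq k) * Real.exp (-(σ₂ * Real.sqrt (freqNormSq k)))) ^ 4 with hQ
  have hQ0 : 0 ≤ Q := by positivity
  refine ⟨max (2 * KA) 0 + 2 * Q, by positivity, fun u δ w hu hδ hw hrz hGu D hGδ ε hε => ?_⟩
  obtain ⟨hM, hΛ, -, hY, -, -⟩ := hB u hu hGu
  have hε0 : 0 ≤ ε := nonneg_of_sum_le hε
  have hr : IsSmooth (fun x => δ x - w x) := hδ.sub hw
  -- the linear and the quadratic part
  have hlin := h1_linearisation_le hd (ν := ν) hu hM hΛ hY hK₃ hK₃pos.le hr hrz hε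
  have hquad := h1_convect_self_le_of_gevreyBound hd hσ₂ hδ hGδ
  rw [← hQ] at hquad
  -- algebra: the difference of the unprojected fields
  have hY₁ : IsSmooth (fun y => ν • laplacian δ y - (convect u δ y + convect δ u y) - convect δ δ y) :=
    ((hδ.laplacian.smul ν).sub ((hu.convect hδ).add (hδ.convect hu))).sub (hδ.convect hδ)
  have hY₂ : IsSmooth (fun y => ν • laplacian w y - (convect u w y + convect w u y)) :=
    (hw.laplacian.smul ν).sub ((hu.convect hw).add (hw.convect hu))
  have hAs : IsSmooth (fun x => ν • laplacian (fun z => δ z - w z) x -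
      (convect u (fun z => δ z - w z) x + convect (fun z => δ z - w z) u x)) :=
    (hr.laplacian.smul ν).sub ((hu.convect hr).add (hr.convect hu))
  have hdiff : ∀ x, (ν • laplacian δ x - (convect u δ x + convect δ u x) - convect δ δ x) -
      (ν • laplacian w x - (convect u w x + convect w u x)) =
      (ν • laplacian (fun z => δ z - w z) x - (convect u (fun z => δ z - w z) x + convect (fun z => δ z - w z) u x)) -
        convect δ δ x := by
    intro x
    have hL : laplacian (fun z => δ z - w z) x = laplacian δ x - laplacian w x := by
      rw [show (fun z => δ z - w z) = δ - w from rfl, laplacian_sub hδ hw, Pi.sub_apply]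
    have hC1 : convect u (fun z => δ z - w z) x = convect u δ x - convect u w x := by
      rw [show (fun z => δ z - w z) = δ - w from rfl]
      simp only [convect, Torus.fderiv_sub (hδ.isContDiff (by simp)) (hw.isContDiff (by simp)) x, sub_apply]
    have hC2 : convect (fun z => δ z - w z) u x = convect δ u x - convect w u x := by
      simp only [convect, map_sub]
    rw [hL, hC1, hC2, smul_sub]
    abel
  -- contraction of `P` and assembly
  refine (h1_leray_sub_le_of_sub_eq hY₁ hY₂ hAs (hδ.convect hδ) hdiff hlin hquad).trans ?_
  have hKA' : (2 * ν ^ 2 * ((4 * Real.pi ^ 2) ^ 2 + (4 * Real.pi ^ 2) ^ 3) +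
      2 * (18 * B ^ 2 + (6 * B ^ 2 + 72 * B ^ 2) * (4 * Real.pi ^ 2) + 12 * B ^ 2 * (4 * Real.pi ^ 2) ^ 2 +
        12 * K₃ * (4 * Real.pi ^ 2 + (4 * Real.pi ^ 2) ^ 2) * B)) * ε ≤ max (2 * KA) 0 / 2 * ε := by
    refine mul_le_mul_of_nonneg_right ?_ hε0
    rw [← hKA]
    have := le_max_left (2 * KA) 0
    linarith
  have hexp : (max (2 * KA) 0 + 2 * Q) * (ε + D ^ 2) =
      2 * (max (2 * KA) 0 / 2 * ε) + max (2 * KA) 0 * D ^ 2 + 2 * Q * ε + 2 * (Q * D ^ 2) := by ring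
  have h1 : 0 ≤ max (2 * KA) 0 * D ^ 2 := by positivity
  have h2 : 0 ≤ 2 * Q * ε := by positivity
  linarith

end Remainder

end Torus

end Literature.Analysis.FluidPDE

end
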